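import Summits.CriticalPhenomena.PercolationContinuityZ3.Theorems.PercNearOneGluingNoHeavyLowerTailCovTriangleTypedOfR2
import HarnessLib

/-!
# `NoHeavyLowerTail` (stmt-CriticalPhenomena-4575) — R2 and the covariance triangle CT hold for EVERY typed instance (two-row proof)

Support file (prover prim-facecert gen 11; `--supports stmt-CriticalPhenomena-4575`).  No definitions, no named facts, no sorries.

The cubic `R2 := μ(U)·μ(D∩Aᶜ)·μ(D∩Bᶜ) − μ(D)²·μ(U∩Aᶜ∩Bᶜ)` (`D = Uᶜ`) of `…CovTriangleOfR2` / `…CovTrianglePath` is the sum of two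
known rows times linear monomials (exact identity at total mass one):

  `R2 = μ(U)·[ μ(D∩Aᶜ)μ(D∩Bᶜ) − μ(D)μ(D∩Aᶜ∩Bᶜ) ]  +  μ(D)·[ μ(U)μ(Aᶜ∩Bᶜ) − μ(U∩Aᶜ∩Bᶜ) ]`.

The first bracket is the two-set/BHK row in complement form (the same polynomial as `μ(D∩A)μ(D∩B) − μ(D)μ(D∩A∩B)`), the second is
Harris for the increasing `U` and the decreasing `Aᶜ∩Bᶜ`.  Hence (`r2_of_twoSet_harris`) R2 holds in ANY probability space in which these two
rows hold, and with `covTriangle_of_r2` so does the covariance triangle (`covTriangle_of_twoSet_harris`).  For `μ = prodBernoulli w`, vertex sets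
`S, T`, `D = {S ↮ T}`, `A` increasing of type (+) and `B` increasing of type (−) for `(C_S, C_T)` both rows are theorems
(`setTwoClusterExchange`, `prodBernoulli_harris_upper_lower`), so **R2(S,T,A,B) and CT(S,T,A,B) hold unconditionally for every typed instance on
every finite weighted graph** (`r2_typed`, `covTriangle_typed`) — in particular for all of prim-ineq-prove-3's four- and five-point typed instances
at once (this supersedes the orbit-by-orbit certificates of prim-facecert gen 10 and the partial five-point census).
-/

noncomputable section

namespace Summit.CriticalPhenomena.PercolationContinuityZ3.Theorems

namespace CovTrianglePath

open MeasureTheory Set Literature.Probability.Percolation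
open Literature.Probability.LatticeModels (prodBernoulli prodBernoulli_harris prodBernoulli_harris_upper_lower)

/-- **R2 ⟸ two-set row + Harris(up, down) (any probability space).**  If `μ(Uᶜ)μ(Uᶜ∩A∩B) ≤ μ(Uᶜ∩A)μ(Uᶜ∩B)` and
`μ(U∩(Aᶜ∩Bᶜ)) ≤ μ(U)μ(Aᶜ∩Bᶜ)` then `μ(Uᶜ)²·μ(U∩Aᶜ∩Bᶜ) ≤ μ(U)·μ(Uᶜ∩Aᶜ)·μ(Uᶜ∩Bᶜ)`.  Proof: the identity in the file docstring. [this work] -/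
theorem r2_of_twoSet_harris {Ω : Type*} [MeasurableSpace Ω] (μ : Measure Ω) [IsProbabilityMeasure μ] {U A B : Set Ω}
    (hU : MeasurableSet U) (hA : MeasurableSet A) (hB : MeasurableSet B)
    (hCA : μ.real Uᶜ * μ.real (Uᶜ ∩ A ∩ B) ≤ μ.real (Uᶜ ∩ A) * μ.real (Uᶜ ∩ B))
    (hUE : μ.real (U ∩ (Aᶜ ∩ Bᶜ)) ≤ μ.real U * μ.real (Aᶜ ∩ Bᶜ)) :
    μ.real Uᶜ ^ 2 * μ.real (U ∩ Aᶜ ∩ Bᶜ) ≤ μ.real U * μ.real (Uᶜ ∩ Aᶜ) * μ.real (Uᶜ ∩ Bᶜ) := by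
  -- atoms: u = μU, d = μUᶜ (= 1 - u), x = μ(Uᶜ∩A), y = μ(Uᶜ∩B), z = μ(Uᶜ∩A∩B), m = μ(U∩Aᶜ∩Bᶜ); every other mass is affine in them
  have eD : μ.real Uᶜ = 1 - μ.real U := probReal_compl_eq_one_sub hU
  have eDnA : μ.real (Uᶜ ∩ Aᶜ) = μ.real Uᶜ - μ.real (Uᶜ ∩ A) := by
    have h := measureReal_inter_add_sdiff (μ := μ) (s := Uᶜ) hA
    rw [Set.sdiff_eq] at h
    linarith
  have eDnB : μ.real (Uᶜ ∩ Bᶜ) = μ.real Uᶜ - μ.real (Uᶜ ∩ B) := by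
    have h := measureReal_inter_add_sdiff (μ := μ) (s := Uᶜ) hB
    rw [Set.sdiff_eq] at h
    linarith
  have eDnAB : μ.real (Uᶜ ∩ Aᶜ ∩ B) = μ.real (Uᶜ ∩ B) - μ.real (Uᶜ ∩ A ∩ B) := by
    have h := measureReal_inter_add_sdiff (μ := μ) (s := Uᶜ ∩ B) hA
    rw [Set.sdiff_eq, Set.inter_right_comm Uᶜ B A, Set.inter_right_comm Uᶜ B Aᶜ] at h
    linarith
  have eDnAnB : μ.real (Uᶜ ∩ Aᶜ ∩ Bᶜ) = μ.real (Uᶜ ∩ Aᶜ) - μ.real (Uᶜ ∩ Aᶜ ∩ B) := by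
    have h := measureReal_inter_add_sdiff (μ := μ) (s := Uᶜ ∩ Aᶜ) hB
    rw [Set.sdiff_eq] at h
    linarith
  have eE : μ.real (Aᶜ ∩ Bᶜ) = μ.real (U ∩ Aᶜ ∩ Bᶜ) + μ.real (Uᶜ ∩ Aᶜ ∩ Bᶜ) := by
    have h := measureReal_inter_add_sdiff (μ := μ) (s := Aᶜ ∩ Bᶜ) hU
    rw [Set.sdiff_eq, Set.inter_comm (Aᶜ ∩ Bᶜ) U, Set.inter_comm (Aᶜ ∩ Bᶜ) Uᶜ, ← Set.inter_assoc,
      ← Set.inter_assoc] at h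
    linarith
  have eUE : μ.real (U ∩ (Aᶜ ∩ Bᶜ)) = μ.real (U ∩ Aᶜ ∩ Bᶜ) := by rw [← Set.inter_assoc]
  have hu : 0 ≤ μ.real U := measureReal_nonneg
  have hd : 0 ≤ μ.real Uᶜ := measureReal_nonneg
  -- Harris in quotient form: d·m ≤ u·μ(Uᶜ∩Aᶜ∩Bᶜ)
  have h1 : μ.real Uᶜ * μ.real (U ∩ Aᶜ ∩ Bᶜ) ≤ μ.real U * μ.real (Uᶜ ∩ Aᶜ ∩ Bᶜ) := by
    rw [eUE, eE] at hUE
    rw [eD]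
    linarith
  have p1 := mul_le_mul_of_nonneg_left hCA hu
  have p2 := mul_le_mul_of_nonneg_left h1 hd
  rw [eDnAnB, eDnAB, eDnA] at p2
  rw [eDnA, eDnB]
  linarith [p1, p2]

/-- **CT ⟸ two-set row + three Harris rows (any probability space).**  The covariance triangle
`μ(D)²·Cov(A,B) ≤ μ(D∩Bᶜ)·Cov(U,A) + μ(D∩Aᶜ)·Cov(U,B)` (`D = Uᶜ`) follows from `μ(D)μ(D∩A∩B) ≤ μ(D∩A)μ(D∩B)`,
`μ(U)μ(A) ≤ μ(U∩A)`, `μ(U)μ(B) ≤ μ(U∩B)` and `μ(U∩(Aᶜ∩Bᶜ)) ≤ μ(U)μ(Aᶜ∩Bᶜ)` (`covTriangle_of_r2` + `r2_of_twoSet_harris`). [this work] -/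
theorem covTriangle_of_twoSet_harris {Ω : Type*} [MeasurableSpace Ω] (μ : Measure Ω) [IsProbabilityMeasure μ] {U A B : Set Ω}
    (hU : MeasurableSet U) (hA : MeasurableSet A) (hB : MeasurableSet B)
    (hCA : μ.real Uᶜ * μ.real (Uᶜ ∩ A ∩ B) ≤ μ.real (Uᶜ ∩ A) * μ.real (Uᶜ ∩ B))
    (hUA : μ.real U * μ.real A ≤ μ.real (U ∩ A)) (hUB : μ.real U * μ.real B ≤ μ.real (U ∩ B))
    (hUE : μ.real (U ∩ (Aᶜ ∩ Bᶜ)) ≤ μ.real U * μ.real (Aᶜ ∩ Bᶜ)) :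
    μ.real Uᶜ ^ 2 * (μ.real (A ∩ B) - μ.real A * μ.real B) ≤
      μ.real (Uᶜ ∩ Bᶜ) * (μ.real (U ∩ A) - μ.real U * μ.real A) +
        μ.real (Uᶜ ∩ Aᶜ) * (μ.real (U ∩ B) - μ.real U * μ.real B) :=
  covTriangle_of_r2 μ hU hA hB hCA hUA hUB (r2_of_twoSet_harris μ hU hA hB hCA hUE)

variable {V : Type*} [Fintype V] (w : Sym2 V → unitInterval) (S T : Set V)

/-- **Typed R2, unconditionally.**  For `μ = prodBernoulli w`, vertex sets `S, T` with `D = {S ↮ T}`, an increasing event `A` of type (+) and an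
increasing event `B` of type (−) for `(C_S, C_T)`:  `μ(D)²·μ(Dᶜ ∩ Aᶜ ∩ Bᶜ) ≤ μ(Dᶜ)·μ(D ∩ Aᶜ)·μ(D ∩ Bᶜ)`
(two-set row `setTwoClusterExchange` + Harris `prodBernoulli_harris_upper_lower`, via `r2_of_twoSet_harris`). [this work] -/
theorem r2_typed {A B : Set (BondConfig V)} (hAup : IsUpperSet A) (hBup : IsUpperSet B)
    (hA : ∀ ⦃ω ω' : BondConfig V⦄, (⋃ s ∈ S, openEdgeCluster ω s) ⊆ (⋃ s ∈ S, openEdgeCluster ω' s) →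
      (⋃ t ∈ T, openEdgeCluster ω' t) ⊆ (⋃ t ∈ T, openEdgeCluster ω t) → ω ∈ A → ω' ∈ A)
    (hB : ∀ ⦃ω ω' : BondConfig V⦄, (⋃ s ∈ S, openEdgeCluster ω' s) ⊆ (⋃ s ∈ S, openEdgeCluster ω s) →
      (⋃ t ∈ T, openEdgeCluster ω t) ⊆ (⋃ t ∈ T, openEdgeCluster ω' t) → ω ∈ B → ω' ∈ B) :
    (prodBernoulli w).real {ω : BondConfig V | ∀ s ∈ S, ∀ t ∈ T, ¬ (openGraph ω).Reachable s t} ^ 2 *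
        (prodBernoulli w).real ({ω : BondConfig V | ∀ s ∈ S, ∀ t ∈ T, ¬ (openGraph ω).Reachable s t}ᶜ ∩ Aᶜ ∩ Bᶜ) ≤
      (prodBernoulli w).real {ω : BondConfig V | ∀ s ∈ S, ∀ t ∈ T, ¬ (openGraph ω).Reachable s t}ᶜ *
        (prodBernoulli w).real ({ω : BondConfig V | ∀ s ∈ S, ∀ t ∈ T, ¬ (openGraph ω).Reachable s t} ∩ Aᶜ) *
        (prodBernoulli w).real ({ω : BondConfig V | ∀ s ∈ S, ∀ t ∈ T, ¬ (openGraph ω).Reachable s t} ∩ Bᶜ) := by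
  set D : Set (BondConfig V) := {ω : BondConfig V | ∀ s ∈ S, ∀ t ∈ T, ¬ (openGraph ω).Reachable s t} with hD
  have hDup : IsUpperSet Dᶜ := (isLowerSet_sepSet (V := V) S T).compl
  -- two-set row (BHK): μ(D ∩ (A ∩ B)) μ(D) ≤ μ(D ∩ A) μ(D ∩ B)
  have hts := setTwoClusterExchange w S T (A₁ := A) (A₂ := Set.univ) (B₁ := B) (B₂ := Set.univ)
    hA (fun _ _ _ _ _ => Set.mem_univ _) hB (fun _ _ _ _ _ => Set.mem_univ _)
  rw [← hD] at hts
  simp only [Set.inter_univ] at hts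
  have hCA : (prodBernoulli w).real Dᶜᶜ * (prodBernoulli w).real (Dᶜᶜ ∩ A ∩ B) ≤
      (prodBernoulli w).real (Dᶜᶜ ∩ A) * (prodBernoulli w).real (Dᶜᶜ ∩ B) := by
    rw [compl_compl, Set.inter_assoc]; linarith [hts]
  -- Harris for the increasing `Dᶜ` and the decreasing `Aᶜ ∩ Bᶜ`
  have hE : IsLowerSet (Aᶜ ∩ Bᶜ) := hAup.compl.inter hBup.compl
  have hUE : (prodBernoulli w).real (Dᶜ ∩ (Aᶜ ∩ Bᶜ)) ≤
      (prodBernoulli w).real Dᶜ * (prodBernoulli w).real (Aᶜ ∩ Bᶜ) :=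
    prodBernoulli_harris_upper_lower w hDup hE MeasurableSet.of_discrete MeasurableSet.of_discrete
  have key := r2_of_twoSet_harris (prodBernoulli w) (U := Dᶜ) (MeasurableSet.of_discrete) (MeasurableSet.of_discrete)
    (MeasurableSet.of_discrete) hCA hUE
  rw [compl_compl] at key
  exact key

/-- **Typed covariance triangle, unconditionally.**  For `μ = prodBernoulli w`, vertex sets `S, T` with `D = {S ↮ T}`, an increasing event `A` of
type (+) and an increasing event `B` of type (−) for `(C_S, C_T)`:
`μ(D)²·(μ(A∩B) − μ(A)μ(B)) ≤ μ(D∩Bᶜ)·(μ(Dᶜ∩A) − μ(Dᶜ)μ(A)) + μ(D∩Aᶜ)·(μ(Dᶜ∩B) − μ(Dᶜ)μ(B))` (prim-ineq-prove-3's CT(S,T,A,B); every four- and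
five-point typed instance is a special case). [this work] -/
theorem covTriangle_typed {A B : Set (BondConfig V)} (hAup : IsUpperSet A) (hBup : IsUpperSet B)
    (hA : ∀ ⦃ω ω' : BondConfig V⦄, (⋃ s ∈ S, openEdgeCluster ω s) ⊆ (⋃ s ∈ S, openEdgeCluster ω' s) →
      (⋃ t ∈ T, openEdgeCluster ω' t) ⊆ (⋃ t ∈ T, openEdgeCluster ω t) → ω ∈ A → ω' ∈ A)
    (hB : ∀ ⦃ω ω' : BondConfig V⦄, (⋃ s ∈ S, openEdgeCluster ω' s) ⊆ (⋃ s ∈ S, openEdgeCluster ω s) →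
      (⋃ t ∈ T, openEdgeCluster ω t) ⊆ (⋃ t ∈ T, openEdgeCluster ω' t) → ω ∈ B → ω' ∈ B) :
    (prodBernoulli w).real {ω : BondConfig V | ∀ s ∈ S, ∀ t ∈ T, ¬ (openGraph ω).Reachable s t} ^ 2 *
        ((prodBernoulli w).real (A ∩ B) - (prodBernoulli w).real A * (prodBernoulli w).real B) ≤
      (prodBernoulli w).real ({ω : BondConfig V | ∀ s ∈ S, ∀ t ∈ T, ¬ (openGraph ω).Reachable s t} ∩ Bᶜ) *
          ((prodBernoulli w).real ({ω : BondConfig V | ∀ s ∈ S, ∀ t ∈ T, ¬ (openGraph ω).Reachable s t}ᶜ ∩ A) -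
            (prodBernoulli w).real {ω : BondConfig V | ∀ s ∈ S, ∀ t ∈ T, ¬ (openGraph ω).Reachable s t}ᶜ * (prodBernoulli w).real A) +
        (prodBernoulli w).real ({ω : BondConfig V | ∀ s ∈ S, ∀ t ∈ T, ¬ (openGraph ω).Reachable s t} ∩ Aᶜ) *
          ((prodBernoulli w).real ({ω : BondConfig V | ∀ s ∈ S, ∀ t ∈ T, ¬ (openGraph ω).Reachable s t}ᶜ ∩ B) -
            (prodBernoulli w).real {ω : BondConfig V | ∀ s ∈ S, ∀ t ∈ T, ¬ (openGraph ω).Reachable s t}ᶜ * (prodBernoulli w).real B) :=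
  covTriangle_typed_of_r2 w S T hAup hBup hA hB (r2_typed w S T hAup hBup hA hB)

end CovTrianglePath

end Summit.CriticalPhenomena.PercolationContinuityZ3.Theorems
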